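import Mathlib
import HarnessLib

/-!
# OSW mechanism — strict shape / velocity quotient (MECHANISM.md v30 §35) — part 01 of 01

1-D model (gCLM/OSW), computer-assisted; not Euler/NS.  Filed under `Summits/NavierStokesRegularity/OSWSelfSimilar/` by a prover-role courier on behalf of the
mechanism seat pub-oswblow-mech (planner-pub-oswblow-mech-g30-0), cell pub-oswblow (host summit NavierStokesRegularity); the gate admits the path but
not role planner.  CONTENT = the staged transcript `pub-oswblow-mech/lean/OSWMechanismStrictShape.lean` (sha256 44394d501ace8b56…,
327 lines), source lines 34–327, UNCHANGED except: (i) namespace prefix `OSWSelfSimilar.Mechanism` → `Summit.NavierStokesRegularity.OSWSelfSimilar.Mechanism`;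
(ii) [parts >= 02 only: the frames open at the cut are re-opened above the body and closed at the end; nothing to re-open here]
(iii) this docstring and, below it, the transcript's own module documentation VERBATIM (renamed).  Generated by `pub-oswblow-mech/lean/courier/make_split.py`; the parts must be filed IN ORDER
(each imports its predecessor).  First/last declarations here: `sin_sq_half_diff` … `WholeBranchInS` (30 in this part).
AI-written transcript; kernel-checked on the farm as ONE file before splitting (see the kit's CHECKS); to be checked, not trusted.
COURIER NOTE (prover-role courier seat pub-oswblow-courier g2, 2026-08-25): in addition to the changes listed above, 4 one-line docstrings were added at filing on the declarations the transcript left undocumented (tree docstring rule); each only restates the formal statement of its declaration; nothing else was touched. List of the added docstrings: HOME `pub-oswblow-courier/g2/DOCSTRINGS.tsv`.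
-/

/-!
# OSW self-similar mechanism — the velocity quotient is monotone in the shape class and the whole negative
branch lies in 𝒮 (MECHANISM.md v30, §35: LEMMA 35.1, THEOREM 35.2 = THEOREM M41, THEOREM 35.3 = THEOREM M42,
COROLLARY 35.4) — the Mathlib-only, kernel-checked part, and the typed statements.

1-D model (gCLM/OSW), computer-assisted; not Euler/NS.

gen 30, planner-pub-oswblow-mech-g30-0, 2026-08-20; v1.1 track.  AI-written; to be checked, not trusted.

Contents (numbers refer to the CHECKS list of §35.9).
(234) the two half-angle identities behind the truncated-sine kernels,
      `sin²((x+y)/2) − sin²((x−y)/2) = sin x·sin y` and `sin²((x+y)/2) + sin²((x−y)/2) = 1 − cos x·cos y`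
      (`sin_sq_half_diff`, `sin_sq_half_sum`), and the sum-to-product pair giving `t = tan(x/2)/tan(y/2)`
      (`sin_half_sum_add`, `sin_half_sum_sub`);
(235) the logarithmic–arithmetic-mean inequality in Padé form, `2(r−1)/(r+1) < log r` for `r > 1`
      (`pade_lt_log`), hence `𝔐(r) = ((r+1)/(2(r−1)))·log r − 1 > 0` (`Mfun_pos`) — the SIGN of the kernel `𝒦₁`;
(236) the algebra `𝒦₁ = −(sin y/π)·𝔐(r)` from the closed forms, given the two identities of (234) and
      `Λ = ½ log r` (`K1_eq_M_form`);
(237) the decomposition `χ = (1−a)(h − A₀) + a(h − G cos x)` under `(1−a)A₀ = 1` (`chi_decomp`), the margin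
      `χ < −(1 + (1−a)B₀)·sin²(x/2)` from `h ≤ e`, `h − G cos x < 0`, `0 < a < 1` (`chi_margin`), the value at the
      sink (`chi_at_pi`), `u′ < 0` from `a g u′ = uχ` (`uderiv_neg`), the logarithmic rate (`log_deriv_bound`);
(238) the strain envelopes `h < A₀ cos x` on `(0,π/2]`, `h < B₀ cos x` on `[π/2,π)`, `h(π/2) < 0`
      (`strain_lt_A0cos`, `strain_lt_B0cos`, `strain_half_neg`);
(239) the order-theoretic skeleton of COROLLARY 35.4: a nonempty subset of `(0,∞)` that is relatively closed and
      relatively open is all of `(0,∞)` (`clopen_in_Ioi_eq`).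
TYPED, NOT PROVED HERE (docstrings say so; no axiom, no `sorry`): the kernels `Lam`, `truncStrain`, `truncVel`,
`K1`, the function `Mfun`; the statements `VelocityQuotientStrictAnti` (THEOREM M41), `DefectMargin` (THEOREM M42),
`WholeBranchInS` (COROLLARY 35.4) over abstract profile data — the analytic branch 𝔎 of THEOREM M32 and the
layer-cake representation of THEOREM M27 are not formalised.
-/

noncomputable section

open Set Real

namespace Summit.NavierStokesRegularity.OSWSelfSimilar.Mechanism.StrictShape

/-! ### (234) Half-angle identities -/

/-- `sin²((x+y)/2) − sin²((x−y)/2) = sin x · sin y`. -/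
theorem sin_sq_half_diff (x y : ℝ) :
    Real.sin ((x + y) / 2) ^ 2 - Real.sin ((x - y) / 2) ^ 2 = Real.sin x * Real.sin y := by
  have hx : x = (x + y) / 2 + (x - y) / 2 := by ring
  have hy : y = (x + y) / 2 - (x - y) / 2 := by ring
  set A := (x + y) / 2 with hA
  set B := (x - y) / 2 with hB
  rw [hx, hy, Real.sin_add, Real.sin_sub]
  have h1 := Real.sin_sq_add_cos_sq A
  have h2 := Real.sin_sq_add_cos_sq B
  nlinarith [h1, h2]

/-- `sin²((x+y)/2) + sin²((x−y)/2) = 1 − cos x · cos y`. -/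
theorem sin_sq_half_sum (x y : ℝ) :
    Real.sin ((x + y) / 2) ^ 2 + Real.sin ((x - y) / 2) ^ 2 = 1 - Real.cos x * Real.cos y := by
  have hx : x = (x + y) / 2 + (x - y) / 2 := by ring
  have hy : y = (x + y) / 2 - (x - y) / 2 := by ring
  set A := (x + y) / 2 with hA
  set B := (x - y) / 2 with hB
  rw [hx, hy, Real.cos_add, Real.cos_sub]
  have h1 := Real.sin_sq_add_cos_sq A
  have h2 := Real.sin_sq_add_cos_sq B
  nlinarith [h1, h2]

/-- `sin((x+y)/2) + sin((x−y)/2) = 2 sin(x/2) cos(y/2)`. -/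
theorem sin_half_sum_add (x y : ℝ) :
    Real.sin ((x + y) / 2) + Real.sin ((x - y) / 2) = 2 * Real.sin (x / 2) * Real.cos (y / 2) := by
  have h1 : (x + y) / 2 = x / 2 + y / 2 := by ring
  have h2 : (x - y) / 2 = x / 2 - y / 2 := by ring
  rw [h1, h2, Real.sin_add, Real.sin_sub]
  ring

/-- `sin((x+y)/2) − sin((x−y)/2) = 2 cos(x/2) sin(y/2)` (so the ratio of the two is `tan(x/2)/tan(y/2)`,
the variable `t` of [HQWW23, Appendix A]). -/
theorem sin_half_sum_sub (x y : ℝ) :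
    Real.sin ((x + y) / 2) - Real.sin ((x - y) / 2) = 2 * Real.cos (x / 2) * Real.sin (y / 2) := by
  have h1 : (x + y) / 2 = x / 2 + y / 2 := by ring
  have h2 : (x - y) / 2 = x / 2 - y / 2 := by ring
  rw [h1, h2, Real.sin_add, Real.sin_sub]
  ring

/-! ### (235) The logarithmic–arithmetic mean inequality, Padé form -/

/-- The auxiliary function `φ(r) = log r + 4/(r+1)` (`= log r − 2(r−1)/(r+1) + 2`). -/
def phi (r : ℝ) : ℝ := Real.log r + 4 / (r + 1)

/-- For `r > 0`, `φ(r) = log r + 4/(r+1)` has derivative `1/r − 4/(r+1)²` at `r`. -/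
theorem phi_hasDerivAt (r : ℝ) (hr : 0 < r) :
    HasDerivAt phi (1 / r - 4 / (r + 1) ^ 2) r := by
  have hr1 : r + 1 ≠ 0 := by linarith
  have h1 : HasDerivAt (fun s : ℝ => Real.log s) (1 / r) r := by
    have := Real.hasDerivAt_log (ne_of_gt hr)
    simpa [one_div] using this
  have h2 : HasDerivAt (fun s : ℝ => (4 : ℝ) / (s + 1)) ((0 * (r + 1) - 4 * 1) / (r + 1) ^ 2) r :=
    (hasDerivAt_const r (4 : ℝ)).div ((hasDerivAt_id' r).add_const 1) hr1
  have h3 := h1.add h2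
  have e1 : phi = fun s : ℝ => Real.log s + 4 / (s + 1) := by
    funext s; rfl
  rw [e1]
  apply h3.congr_deriv
  ring

/-- `0 < φ′(r)` for `r > 1` (`φ(r) = log r + 4/(r+1)`). -/
theorem phi_deriv_pos (r : ℝ) (hr : 1 < r) : 0 < deriv phi r := by
  have hr0 : 0 < r := by linarith
  rw [(phi_hasDerivAt r hr0).deriv]
  have hr1 : 0 < r + 1 := by linarith
  have key : 1 / r - 4 / (r + 1) ^ 2 = (r - 1) ^ 2 / (r * (r + 1) ^ 2) := by
    field_simp
    ring
  rw [key]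
  apply div_pos
  · have : 0 < r - 1 := by linarith
    positivity
  · positivity

/-- `φ(r) = log r + 4/(r+1)` is continuous on `[1, ∞)`. -/
theorem phi_continuousOn : ContinuousOn phi (Ici 1) := by
  intro r hr
  have hr0 : 0 < r := lt_of_lt_of_le one_pos hr
  exact (phi_hasDerivAt r hr0).continuousAt.continuousWithinAt

/-- `φ(r) = log r + 4/(r+1)` is strictly increasing on `[1, ∞)`. -/
theorem phi_strictMonoOn : StrictMonoOn phi (Ici 1) := by
  apply strictMonoOn_of_deriv_pos (convex_Ici 1) phi_continuousOn
  intro r hr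
  rw [interior_Ici] at hr
  exact phi_deriv_pos r hr

/-- (235) `2(r−1)/(r+1) < log r` for `r > 1`: the logarithmic mean of `1, r` is below their arithmetic mean
([Bullen, A Dictionary of Inequalities, 'Logarithmic Mean Inequalities' (1)]; = [HQWW23, Lemma 7.1(3)] in the
variable `t`, `r = ((t+1)/(t−1))²`). -/
theorem pade_lt_log (r : ℝ) (hr : 1 < r) : 2 * (r - 1) / (r + 1) < Real.log r := by
  have h := phi_strictMonoOn (self_mem_Ici : (1 : ℝ) ∈ Ici 1) (le_of_lt hr : (1 : ℝ) ≤ r) hr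
  simp only [phi, Real.log_one, zero_add] at h
  have hr1 : 0 < r + 1 := by linarith
  have e : 2 * (r - 1) / (r + 1) = 2 - 4 / (r + 1) := by
    field_simp
    ring
  rw [e]
  norm_num at h
  linarith

/-- The kernel sign function `𝔐(r) = ((r+1)/(2(r−1)))·log r − 1`. -/
def Mfun (r : ℝ) : ℝ := (r + 1) / (2 * (r - 1)) * Real.log r - 1

/-- (235) `𝔐(r) > 0` for `r > 1`. -/
theorem Mfun_pos (r : ℝ) (hr : 1 < r) : 0 < Mfun r := by
  have h := pade_lt_log r hr
  have hr1 : 0 < r + 1 := by linarith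
  have hr2 : 0 < r - 1 := by linarith
  unfold Mfun
  have hpos : 0 < (r + 1) / (2 * (r - 1)) := by positivity
  have h' : (r + 1) / (2 * (r - 1)) * (2 * (r - 1) / (r + 1)) < (r + 1) / (2 * (r - 1)) * Real.log r :=
    mul_lt_mul_of_pos_left h hpos
  have e : (r + 1) / (2 * (r - 1)) * (2 * (r - 1) / (r + 1)) = 1 := by
    field_simp
  linarith

/-! ### (236) The kernel identity `𝒦₁ = −(sin y/π)·𝔐(r)` (algebra) -/

/-- (236) With `p = sin²((x+y)/2)`, `m = sin²((x−y)/2)`, `S = sin x`, `T = sin y`, `C = 1 − cos x cos y`, the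
identities of (234) `S·T = p − m`, `C = p + m`, and `Λ = ½ log(p/m)`, the kernel
`𝒦₁ = (1/π)(T − Λ·C/S)` equals `−(T/π)·𝔐(p/m)`.  Hypotheses `S ≠ 0`, `m ≠ 0`, `p ≠ m`. -/
theorem K1_eq_M_form (p m S T C Λ : ℝ) (hS : S ≠ 0) (hm : m ≠ 0) (hpm : p ≠ m)
    (h1 : S * T = p - m) (h2 : C = p + m) (hΛ : Λ = (1 / 2) * Real.log (p / m)) :
    (1 / Real.pi) * (T - Λ * C / S) = -(T / Real.pi) * Mfun (p / m) := by
  unfold Mfun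
  have hpi : Real.pi ≠ 0 := Real.pi_ne_zero
  have hr1 : p / m - 1 ≠ 0 := by
    intro h
    apply hpm
    field_simp at h
    linarith
  have hT : T = (p - m) / S := by
    field_simp
    linarith [h1]
  rw [hΛ, h2, hT]
  field_simp
  ring

/-! ### (237) The transport defect: decomposition, margin, sign of `u′` -/

/-- (237) `χ = h − 1 − a·G·cos x = (1−a)(h − A₀) + a(h − G cos x)` when `(1−a)A₀ = 1` (`q₀ = 1`). -/
theorem chi_decomp (a A0 h G c : ℝ) (hq : (1 - a) * A0 = 1) :
    h - 1 - a * G * c = (1 - a) * (h - A0) + a * (h - G * c) := by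
  linear_combination hq

/-- (237) THEOREM M42's inequality from its two inputs: the strain envelope `h ≤ e = A₀ − (A₀+B₀)·s2`
(`s2 = sin²(x/2)`; M27(i), indeed `h < e`) and the velocity-quotient inequality `h − G cos x < 0` (M41),
with `0 < a < 1`, `(1−a)A₀ = 1`, `0 ≤ s2`: `χ < −(1 + (1−a)B₀)·s2`. -/
theorem chi_margin (a A0 B0 h G c s2 : ℝ) (hq : (1 - a) * A0 = 1) (ha0 : 0 < a) (ha1 : a < 1)
    (henv : h ≤ A0 - (A0 + B0) * s2) (hD : h - G * c < 0) :
    h - 1 - a * G * c < -(1 + (1 - a) * B0) * s2 := by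
  rw [chi_decomp a A0 h G c hq]
  have h1a : 0 < 1 - a := by linarith
  have t1 : (1 - a) * (h - A0) ≤ (1 - a) * (-(A0 + B0) * s2) :=
    mul_le_mul_of_nonneg_left (by linarith) h1a.le
  have t2 : a * (h - G * c) < 0 := mul_neg_of_pos_of_neg ha0 hD
  have e : (1 - a) * (-(A0 + B0) * s2) = -(1 + (1 - a) * B0) * s2 := by
    have : (1 - a) * (A0 + B0) = 1 + (1 - a) * B0 := by linear_combination hq
    linear_combination (-s2) * this
  linarith

/-- (237) The value at the sink: with `h(π) = −B₀`, `G(π) = B₀`, `cos π = −1`: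
`χ(π) = −B₀ − 1 − a·B₀·(−1) = −(1 + (1−a)B₀)` — equality in `chi_margin` at `x = π` (`s2 = 1`). -/
theorem chi_at_pi (a B0 : ℝ) : -B0 - 1 - a * B0 * (-1) = -(1 + (1 - a) * B0) * 1 := by ring

/-- (237) From `a·g·u′ = u·χ` ((22.16)/(34.3)) with `a, g, u > 0` and `χ < 0`: `u′ < 0`. -/
theorem uderiv_neg (a g u χ u' : ℝ) (heq : a * g * u' = u * χ) (ha : 0 < a) (hg : 0 < g) (hu : 0 < u)
    (hχ : χ < 0) : u' < 0 := by
  have hag : 0 < a * g := mul_pos ha hg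
  have hneg : a * g * u' < 0 := by rw [heq]; exact mul_neg_of_pos_of_neg hu hχ
  by_contra hc
  have hc' : 0 ≤ u' := not_lt.mp hc
  have := mul_nonneg hag.le hc'
  linarith

/-- (237) The logarithmic rate: if `χ ≤ −κ·s2` with `κ ≥ 0`, `0 < g ≤ A₀·s` (`s = sin x > 0`; the upper velocity
chord of COROLLARY 35.5) and `a > 0`, then `χ/(a g) ≤ −κ·s2/(a·A₀·s)` (`= −κ·tan(x/2)/(2aA₀)` since
`sin²(x/2)/sin x = ½tan(x/2)`). -/
theorem log_deriv_bound (a A0 g s s2 κ χ : ℝ) (ha : 0 < a) (hg : 0 < g) (hgs : g ≤ A0 * s) (hs2 : 0 ≤ s2)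
    (hκ : 0 ≤ κ) (hχ : χ ≤ -κ * s2) :
    χ / (a * g) ≤ -κ * s2 / (a * A0 * s) := by
  have hAs : 0 < A0 * s := lt_of_lt_of_le hg hgs
  have hag : 0 < a * g := mul_pos ha hg
  have haAs : 0 < a * (A0 * s) := mul_pos ha hAs
  have hχneg : χ ≤ 0 := by nlinarith
  -- χ/(a g) ≤ χ/(a A0 s) ≤ −κ s2/(a A0 s)
  have step1 : χ / (a * g) ≤ χ / (a * (A0 * s)) := by
    rw [div_le_div_iff₀ hag haAs]
    have hle : a * g ≤ a * (A0 * s) := mul_le_mul_of_nonneg_left hgs ha.le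
    nlinarith [mul_le_mul_of_nonpos_left hle hχneg]
  have step2 : χ / (a * (A0 * s)) ≤ -κ * s2 / (a * A0 * s) := by
    rw [show a * (A0 * s) = a * A0 * s by ring]
    exact div_le_div_of_nonneg_right hχ (by rw [← mul_assoc] at haAs; exact haAs.le)
  exact le_trans step1 step2

/-! ### (238) The strain envelopes of COROLLARY 35.5 -/

/-- On `(0, π/2]` (`cos x ≥ 0`): `h < G cos x ≤ A₀ cos x` since `G ≤ A₀ = G(0⁺)` (M41). -/
theorem strain_lt_A0cos (h G A0 c : ℝ) (hD : h - G * c < 0) (hG : G ≤ A0) (hc : 0 ≤ c) : h < A0 * c := by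
  nlinarith [mul_le_mul_of_nonneg_right hG hc]

/-- On `[π/2, π)` (`cos x ≤ 0`): `h < G cos x ≤ B₀ cos x` since `G ≥ B₀ = G(π⁻)` (M41). -/
theorem strain_lt_B0cos (h G B0 c : ℝ) (hD : h - G * c < 0) (hG : B0 ≤ G) (hc : c ≤ 0) : h < B0 * c := by
  nlinarith [mul_le_mul_of_nonpos_right hG hc]

/-- At `x = π/2`: `h(π/2) < 0`. -/
theorem strain_half_neg (h G : ℝ) (hD : h - G * 0 < 0) : h < 0 := by simpa using hD

/-! ### (239) The order-theoretic skeleton of COROLLARY 35.4 -/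

/-- (239) A nonempty subset `T` of `(0,∞)` which is relatively closed (`T = C ∩ (0,∞)`, `C` closed) and relatively
open (`T = U ∩ (0,∞)`, `U` open) is all of `(0,∞)` — by the connectedness of `(0,∞)`.  In COROLLARY 35.4:
`T = {σ : f(σ) ∈ 𝒮}` is closed (COROLLARY 34.5(b)), open (THEOREM M42 with COROLLARY 34.5(b)), and contains
`(0, ε_𝒮 ∧ ε₄]` (THEOREM M39). -/
theorem clopen_in_Ioi_eq {T C U : Set ℝ} (hC : IsClosed C) (hU : IsOpen U) (hTC : T = C ∩ Ioi 0)
    (hTU : T = U ∩ Ioi 0) (hne : T.Nonempty) : T = Ioi 0 := by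
  have hpre : IsPreconnected (Ioi (0 : ℝ)) := isPreconnected_Ioi
  -- cover (0,∞) by U and Cᶜ
  have hcover : Ioi (0 : ℝ) ⊆ U ∪ Cᶜ := by
    intro x hx
    by_cases hxC : x ∈ C
    · left
      have : x ∈ T := by rw [hTC]; exact ⟨hxC, hx⟩
      rw [hTU] at this
      exact this.1
    · right; exact hxC
  have hU' : (Ioi (0 : ℝ) ∩ U).Nonempty := by
    obtain ⟨x, hx⟩ := hne
    rw [hTU] at hx
    exact ⟨x, hx.2, hx.1⟩
  -- if (0,∞) met Cᶜ, preconnectedness would give a point of (0,∞) ∩ U ∩ Cᶜ, impossible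
  have hCc : ¬ (Ioi (0 : ℝ) ∩ Cᶜ).Nonempty := by
    intro hV
    obtain ⟨x, hx, hxU, hxC⟩ := hpre U Cᶜ hU hC.isOpen_compl hcover hU' hV
    have : x ∈ T := by rw [hTU]; exact ⟨hxU, hx⟩
    rw [hTC] at this
    exact hxC this.1
  -- hence (0,∞) ⊆ C and T = (0,∞)
  apply Subset.antisymm
  · rw [hTC]; exact inter_subset_right
  · intro x hx
    rw [hTC]
    refine ⟨?_, hx⟩
    by_contra hxC
    exact hCc ⟨x, hx, hxC⟩

/-! ### Typed statements (no axiom, no `sorry`; PROVED pen-and-paper in MECHANISM.md §35, not kernel-checked) -/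

/-- The velocity kernel `Λ(x,y) = log( sin((x+y)/2) / |sin((x−y)/2)| )` of (17.1). -/
def Lam (x y : ℝ) : ℝ := Real.log (Real.sin ((x + y) / 2) / |Real.sin ((x - y) / 2)|)

/-- LEMMA 35.1(a): the strain of the truncated sine `F_y = sin·𝟙_{(0,y)}` (odd extension),
`𝔥(x,y) = (1/π)(y cos x + sin y − sin x·Λ(x,y))`. -/
def truncStrain (x y : ℝ) : ℝ := (1 / Real.pi) * (y * Real.cos x + Real.sin y - Real.sin x * Lam x y)

/-- LEMMA 35.1(a): the velocity of the truncated sine, `𝔤(x,y) = (1/π)(y sin x + (cos x − cos y)·Λ(x,y))`. -/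
def truncVel (x y : ℝ) : ℝ := (1 / Real.pi) * (y * Real.sin x + (Real.cos x - Real.cos y) * Lam x y)

/-- LEMMA 35.1(b): the kernel `𝒦₁ = 𝔥 − cot x·𝔤`. -/
def K1 (x y : ℝ) : ℝ := truncStrain x y - (Real.cos x / Real.sin x) * truncVel x y

/-- LEMMA 35.1(b) (typed): `𝒦₁(x,y) = −(sin y/π)·𝔐(r)`, `r = sin²((x+y)/2)/sin²((x−y)/2)`, for `x ≠ y` in `(0,π)`;
the algebra is `K1_eq_M_form`, the sign is `Mfun_pos`. -/
def KernelIdentity : Prop :=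
  ∀ x y : ℝ, 0 < x → x < Real.pi → 0 < y → y < Real.pi → x ≠ y →
    K1 x y = -(Real.sin y / Real.pi) * Mfun (Real.sin ((x + y) / 2) ^ 2 / Real.sin ((x - y) / 2) ^ 2)

/-- THEOREM 35.2 = THEOREM M41 (typed): in the shape class 𝒮 (`u = F/sin x` non-increasing on `(0,π)`, negative
class-(H) profile) the velocity quotient `G = g/sin x` is strictly decreasing on `(0,π)`.  Abstract data: the
velocity `g` of the profile. -/
def VelocityQuotientStrictAnti (g : ℝ → ℝ) : Prop :=
  StrictAntiOn (fun x => g x / Real.sin x) (Ioo 0 Real.pi)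

/-- THEOREM 35.3 = THEOREM M42 (typed): for `f ∈ 𝒮` with `q₀ = 1` (so `(1−a)A₀ = 1`, `0 < a < 1`), the transport
defect `χ = h − 1 − a·g·cot x` satisfies `χ(x) < −(1 + (1−a)B₀)·sin²(x/2)` on `(0,π)`. -/
def DefectMargin (a A0 B0 : ℝ) (h g : ℝ → ℝ) : Prop :=
  (1 - a) * A0 = 1 → 0 < a → a < 1 →
    ∀ x ∈ Ioo 0 Real.pi,
      h x - 1 - a * g x * (Real.cos x / Real.sin x) < -(1 + (1 - a) * B0) * Real.sin (x / 2) ^ 2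

/-- COROLLARY 35.4 (typed, order-theoretic content only): along a branch parametrised by `σ ∈ (0,∞)` the shape set
`T = {σ : f(σ) ∈ 𝒮}` is all of `(0,∞)` — `σ_𝒮 = ∞`.  See `clopen_in_Ioi_eq` for the kernel-checked skeleton. -/
def WholeBranchInS (inS : ℝ → Prop) : Prop := ∀ σ : ℝ, 0 < σ → inS σ

end Summit.NavierStokesRegularity.OSWSelfSimilar.Mechanism.StrictShape

end
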